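import Summits.BirchSwinnertonDyer.BirchSwinnertonDyer.Theorems.KimAtThreeFineKatoFinal
import Summits.BirchSwinnertonDyer.BirchSwinnertonDyer.Theorems.KimAtThreeFineKatoPerFactorPartsPrintCrux
import HarnessLib

/-!
# Crux `KatoKuriharaPortThreeShared` (stmt-BirchSwinnertonDyer-19560) BY NAME from five cite facts ∧ **hKatoFin** — the residual of
# record after `KimAtThreeFineKatoFinal` (cell `bsd-addord`, seat kim3 gen 15 = the crux's LEAD; route W2 `KimAtThreeKolyvagin`;
# `--supports 19560`, helper)

HONEST FRAMING. ONE theorem, no definition, no named fact, no instance, no `sorry`.  The five hypotheses (S5a)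
`expStarCoord_eq_zero_iff_kummer`, (S5b-tower) `exists_smul_range_expStarCoord_tower_iff_trace_log`, (P123)
`cupLogInjective_and_hasDualExp_of_isDeRham`, (DR) `isDeRham_restrictedRationalTateRep`, `nonempty_neronDeRhamDatum` are CITE FACTS
(Literature `def … : Prop`, [BK90] §3 / Kato II 1.2.3, 1.3.5 / `dim D⁰_dR = 1`) taken as hypotheses (D-0014) — the theorem is
CONDITIONAL on them; hKatoFin is DISPLAYED.  Nothing is closed; nothing is booked; BSD / 19560 are NOT proved by this file.
Composition: `KimAtThreeFineKatoPerFactorPartsPrintCrux.katoKuriharaPortThreeShared_of_facts_of_printClauses` (p528026)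
∘ `KimAtThreeFineKatoFinal.katoP_of_final` (p529867).

WHAT hKatoFin SAYS (the crux's residual of record, 2026-08-27): for every row `(W, P)` of the stratum — a line datum `dv` of
`D⁰_dR(V_3W|Γ_{ℚ_{v₃}})` with its Prop-1.2.3 binders, `hdual(dv)` («range `exp*_dv` = trace-dual of `log E(ℚ_3)`», [BK90] 3.8 —
an ASSERTION here; w2-acc4's POS road removes it), an embedding family `ι`, a real `κ ≠ 0` with R-κ («`κ ∈ ℚ`, `v_3(κ) = 0`» — the (a″)
derivation from `3 ∤ c_P`, lattice optimality, `X₁/X₀`: OURS, open), and for every auxiliary `(c, d, a, A)` Kato's classes `z` and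
values `x` with the PRINTED clauses (C1) norm relations, (C2) unramifiedness, (C5) the L-value law (Kato 2004 (8.1.3)/8.12/13.3,
9.7 ∘ 6.6 (1)), and (C4) rationality `Λ(z) = 1 ⊗ x` for `Λ :=` the DEFINED semi-local `exp*_ω` (`katoLambda`, w2-acc5) in ANY admissible
chart and ANY (RES₀)-admissible line datum.  Owners: (C1)(C2)(C4)(C5) + `ι κ z x` — the Kato-v2 typer lane (w2-c2 g9, Literature,
general `p`); hdual ↦ POS — w2-acc4; R-κ / (a″) — the LEAD's successor.
-/

noncomputable section

-- the cell's Theorems namespace `Summit.BirchSwinnertonDyer.BirchSwinnertonDyer.…` repeats the summit name by design (D-0017)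
set_option linter.dupNamespace false

open scoped Classical NumberField TensorProduct ContRepresentation Pointwise
open Field ValuativeRel Function IsDedekindDomain NumberField
open WeierstrassCurve Literature.NumberTheory.EllipticCurves Literature.NumberTheory.GaloisRepresentations
  Literature.NumberTheory.GaloisRepresentations.DiscreteGaloisModule Literature.NumberTheory.GaloisCohomology
open Literature.NumberTheory.GaloisRepresentations.PeriodRingData Literature.NumberTheory.PAdicHodge
open Literature.NumberTheory.EllipticCurves.ModularForms Literature.NumberTheory.EllipticCurves.Rank1Residual
open Literature.NumberTheory.EllipticCurves.Kato2004 Literature.NumberTheory.EllipticCurves.Kato2004.EulerSystemValues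
open Literature.NumberTheory.AdelicBaseChange Literature.NumberTheory.Automorphic
open Summit.BirchSwinnertonDyer.Rank1Residual.GaloisImage
open Summit.BirchSwinnertonDyer.Rank1Residual.Additive.LocalLog
open Summit.BirchSwinnertonDyer.BirchSwinnertonDyer.Theorems
open Summit.BirchSwinnertonDyer.BirchSwinnertonDyer.Theorems.KimAtThreeFineKatoPerFactorDefined
open Summit.BirchSwinnertonDyer.BirchSwinnertonDyer.Theorems.KimAtThreeDeepLowerExpStarOmega
open Summit.BirchSwinnertonDyer.BirchSwinnertonDyer.Theorems.KimAtThreeDeepLowerExpStarOmegaPlace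
open Summit.BirchSwinnertonDyer.BirchSwinnertonDyer.Theorems.KimAtThreeFineKatoPerFactorPlaces

open Summit.BirchSwinnertonDyer.BirchSwinnertonDyer.Theorems.KimAtThreeFineKatoDefinedLambda

namespace Summit.BirchSwinnertonDyer.BirchSwinnertonDyer.Theorems.KimAtThreeFineKatoFinalCrux

set_option maxHeartbeats 800000 in
/-- **Crux `KatoKuriharaPortThreeShared` BY NAME from (S5a), (S5b-tower), (P123), (DR), `nonempty_neronDeRhamDatum` (cite facts as
hypotheses — CONDITIONAL) and the displayed hKatoFin.**  NOT a closing theorem.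
[cite: Kato2004Asterisque, (8.1.3) (p. 180), Prop. 8.12 (p. 186), §9.4 and Thm. 9.7 (pp. 188–189), Thm. 6.6 (1) (p. 163), Ex. 13.3 (pp. 224–225)]
[cite: BlochKato1990, §3 (Prop. 3.8, Ex. 3.11)] [cite: Kato1993LNM1553, Ch. II §1.2.4, Prop. 1.2.3 and Ex. 1.3.5]
[cite: BrinonConrad2009, Prop. 6.3.8] [cite: CasselsFrohlichANT1967, Ch. II §10 Theorem (10.2) and Ch. VII Prop. 1.2 (ii)] -/
theorem katoKuriharaPortThreeShared_of_facts_of_final (hA : expStarCoord_eq_zero_iff_kummer)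
    (hT : exists_smul_range_expStarCoord_tower_iff_trace_log) (hP : cupLogInjective_and_hasDualExp_of_isDeRham)
    (hDR : isDeRham_restrictedRationalTateRep) (hND : nonempty_neronDeRhamDatum)
    (hFin : ∀ (W : WeierstrassCurve ℚ) [W.IsElliptic] [W.IsGloballyMinimal]
      [ContinuousSMul ℤ_[3] (W.tateModule 3)] [Module.Free ℤ_[3] (W.tateModule 3)]
      [Module.Finite ℤ_[3] (W.tateModule 3)],
      (∀ m : ℕ, W.HasSurjectiveModNGaloisRep (3 ^ m : ℕ)) →
      (haveI : Fact (Nat.Prime 3) := ⟨Nat.prime_three⟩; Addv W 3) →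
      ¬ 3 ∣ (W.baseChange ℚ_[3]).localTamagawaNumber ℤ_[3] →
      Nat.card {Q : (W.baseChange ℚ_[3]).toAffine.Point // (3 : ℕ) • Q = 0} = 1 →
      ∀ {N : ℕ} [NeZero N] (P : ModularParametrizationData W N), N = W.conductorNorm ℤ →
        (∀ z ∈ P.L.lattice, ∃ w ∈ periodLattice P.f, z = P.c * w) →
        ¬ (3 : ℤ) ∣ P.maninConstant →
        haveI : Fact (((3 : ℕ) : 𝓞 ℚ) ∈ ((Rat.HeightOneSpectrum.primesEquiv (R := 𝓞 ℚ)).symm ⟨3, Fact.out⟩).asIdeal) :=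
          ⟨(natCast_mem_asIdeal_iff_eq_primesEquiv_symm _ Nat.prime_three).mpr rfl⟩
        letI := valuativeRelPlace ((Rat.HeightOneSpectrum.primesEquiv (R := 𝓞 ℚ)).symm ⟨3, Fact.out⟩)
        letI := topologicalSpacePlace ((Rat.HeightOneSpectrum.primesEquiv (R := 𝓞 ℚ)).symm ⟨3, Fact.out⟩)
        haveI := isNonarchimedeanLocalField_place ((Rat.HeightOneSpectrum.primesEquiv (R := 𝓞 ℚ)).symm ⟨3, Fact.out⟩)
        haveI := charZero_place ((Rat.HeightOneSpectrum.primesEquiv (R := 𝓞 ℚ)).symm ⟨3, Fact.out⟩)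
        letI := padicAlgebraPlace 3 ((Rat.HeightOneSpectrum.primesEquiv (R := 𝓞 ℚ)).symm ⟨3, Fact.out⟩)
        haveI := fact_not_isUnit_place 3 ((Rat.HeightOneSpectrum.primesEquiv (R := 𝓞 ℚ)).symm ⟨3, Fact.out⟩)
        haveI := isAdicComplete_place 3 ((Rat.HeightOneSpectrum.primesEquiv (R := 𝓞 ℚ)).symm ⟨3, Fact.out⟩)
        ∃ (dv : LocalNeronLineAt W 3 ((Rat.HeightOneSpectrum.primesEquiv (R := 𝓞 ℚ)).symm ⟨3, Fact.out⟩))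
          (hinj : (bdRPeriodRingData (valuation_place_lt_one 3 ((Rat.HeightOneSpectrum.primesEquiv (R := 𝓞 ℚ)).symm ⟨3, Fact.out⟩))).CupLogInjective (logCyclotomic 3)
            (localRationalTateRep W 3 (galRestrictPlace ((Rat.HeightOneSpectrum.primesEquiv (R := 𝓞 ℚ)).symm ⟨3, Fact.out⟩))))
          (hex : ∀ z : contOneCocycles (localRationalTateRep W 3 (galRestrictPlace ((Rat.HeightOneSpectrum.primesEquiv (R := 𝓞 ℚ)).symm ⟨3, Fact.out⟩))).toTopRep,
            (bdRPeriodRingData (valuation_place_lt_one 3 ((Rat.HeightOneSpectrum.primesEquiv (R := 𝓞 ℚ)).symm ⟨3, Fact.out⟩))).HasDualExp (logCyclotomic 3)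
              (localRationalTateRep W 3 (galRestrictPlace ((Rat.HeightOneSpectrum.primesEquiv (R := 𝓞 ℚ)).symm ⟨3, Fact.out⟩))) fun σ => z.1 σ),
          (∀ a : ℚ_[3], (∃ y, (expStarOmegaPadicAt dv hinj hex (((Padic.adicCompletionEquiv (𝓞 ℚ) ⟨3, Fact.out⟩).symm : (((Rat.HeightOneSpectrum.primesEquiv (R := 𝓞 ℚ)).symm ⟨3, Fact.out⟩).adicCompletion ℚ) →+* ℚ_[3]))) y = a) ↔
            ∀ Q : (W.baseChange ℚ_[3]).toAffine.Point, ‖a * padicLog (W.baseChange ℚ_[3]) Q‖ ≤ 1) ∧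
        ∃ (ι : (n : ℕ) → (CyclotomicField n ℚ →+* ℂ)) (κK : ℝ),
          κK ≠ 0 ∧ (∃ u : ℚ, (u : ℝ) = κK ∧ padicValRat 3 u = 0) ∧
          ∀ (c d a : ℤ) (A : ℕ), 0 < A → Int.gcd c (6 * 3 * A) = 1 → Int.gcd d (6 * 3 * N) = 1 →
            ∃ (z : ∀ (k' : ℕ) (r : (cyclotomicLevelsRat 3 (badPlaces c d A N)).Ideals),
                  H1 (tateRep W 3) ((cyclotomicLevelsRat 3 (badPlaces c d A N)).level k' r.1))
              (x : ∀ (k' : ℕ) (r : (cyclotomicLevelsRat 3 (badPlaces c d A N)).Ideals),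
                  CyclotomicField (cycLevel 3 k' r.1) ℚ),
              IsEulerSystem (cyclotomicLevelsRat 3 (badPlaces c d A N)) (tateRep W 3) 3 z ∧
              (∀ (k : ℕ) (r : (cyclotomicLevelsRat 3 (badPlaces c d A N)).Ideals) (v : HeightOneSpectrum (𝓞 ℚ)), ((Rat.HeightOneSpectrum.primesEquiv v : Nat.Primes) : ℕ) ≠ 3 →
                  ∀ 𝔓 ∈ v.primesAbove,
                    resLe (tateRep W 3).toTopRep
                        (inf_le_left : (cyclotomicLevelsRat 3 (badPlaces c d A N)).level k r.1 ⊓ 𝔓.inertia (absoluteGaloisGroup ℚ) ≤ (cyclotomicLevelsRat 3 (badPlaces c d A N)).level k r.1)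
                        1 (z k r) = 0) ∧
              (∀ (k : ℕ) (r : (cyclotomicLevelsRat 3 (badPlaces c d A N)).Ideals)
              (Ψ : ℚ_[3] ⊗[ℚ] CyclotomicField (cycLevel 3 k r.1) ℚ ≃ₐ[ℚ]
                (Π w : ((Rat.HeightOneSpectrum.primesEquiv (R := 𝓞 ℚ)).symm ⟨3, Fact.out⟩).Extension
                  (𝓞 (CyclotomicField (cycLevel 3 k r.1) ℚ)), w.1.adicCompletion (CyclotomicField (cycLevel 3 k r.1) ℚ)))
              (hΨ : ∀ (s : ℚ_[3]) (x : CyclotomicField (cycLevel 3 k r.1) ℚ)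
                (w : ((Rat.HeightOneSpectrum.primesEquiv (R := 𝓞 ℚ)).symm ⟨3, Fact.out⟩).Extension
                  (𝓞 (CyclotomicField (cycLevel 3 k r.1) ℚ))),
                Ψ (s ⊗ₜ[ℚ] x) w =
                  algebraMap (CyclotomicField (cycLevel 3 k r.1) ℚ) (w.1.adicCompletion (CyclotomicField (cycLevel 3 k r.1) ℚ)) x *
                  algebraMap (((Rat.HeightOneSpectrum.primesEquiv (R := 𝓞 ℚ)).symm ⟨3, Fact.out⟩).adicCompletion ℚ)
                    (w.1.adicCompletion (CyclotomicField (cycLevel 3 k r.1) ℚ)) ((Padic.adicCompletionEquiv (𝓞 ℚ) ⟨3, Fact.out⟩) s))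
              (w₀ : ((Rat.HeightOneSpectrum.primesEquiv (R := 𝓞 ℚ)).symm ⟨3, Fact.out⟩).Extension
                  (𝓞 (CyclotomicField (cycLevel 3 k r.1) ℚ)))
                (g : ((Rat.HeightOneSpectrum.primesEquiv (R := 𝓞 ℚ)).symm ⟨3, Fact.out⟩).Extension
                  (𝓞 (CyclotomicField (cycLevel 3 k r.1) ℚ)) → absoluteGaloisGroup ℚ)
                (hg : ∀ w : ((Rat.HeightOneSpectrum.primesEquiv (R := 𝓞 ℚ)).symm ⟨3, Fact.out⟩).Extension
                  (𝓞 (CyclotomicField (cycLevel 3 k r.1) ℚ)),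
                  sigma (cycLevel 3 k r.1) (modNCyclotomicCharacter ℚ (cycLevel 3 k r.1) (g w)) • w.1 = w₀.1),
                  letI := LocalField.charZero_adicCompletion w₀.1
                  letI := LocalField.adicCompletionPadicAlgebra w₀.1 3 (three_mem_asIdeal_extension _ w₀)
                  haveI : Fact (¬ IsUnit ((3 : ℕ) : integerC (w₀.1.adicCompletion (CyclotomicField (cycLevel 3 k r.1) ℚ)))) :=
                    ⟨not_isUnit_natCast_integerC (LocalField.valuation_adicCompletion_natCast_lt_one w₀.1 3 (three_mem_asIdeal_extension _ w₀))⟩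
                  haveI := isAdicComplete_integerC_natCast (LocalField.valuation_adicCompletion_natCast_lt_one w₀.1 3 (three_mem_asIdeal_extension _ w₀))
                  ∀ (dw : LocalNeronLine W (LocalField.valuation_adicCompletion_natCast_lt_one w₀.1 3 (three_mem_asIdeal_extension _ w₀))
                    ((galRestrictPlace ((Rat.HeightOneSpectrum.primesEquiv (R := 𝓞 ℚ)).symm ⟨3, Fact.out⟩)).comp
                      (absGaloisRestrict (((Rat.HeightOneSpectrum.primesEquiv (R := 𝓞 ℚ)).symm ⟨3, Fact.out⟩).adicCompletion ℚ) (w₀.1.adicCompletion (CyclotomicField (cycLevel 3 k r.1) ℚ)))))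
                    (hinjw : (bdRPeriodRingData (LocalField.valuation_adicCompletion_natCast_lt_one w₀.1 3 (three_mem_asIdeal_extension _ w₀))).CupLogInjective
                    (logCyclotomic 3) (localRationalTateRep W 3 ((galRestrictPlace ((Rat.HeightOneSpectrum.primesEquiv (R := 𝓞 ℚ)).symm ⟨3, Fact.out⟩)).comp
                      (absGaloisRestrict (((Rat.HeightOneSpectrum.primesEquiv (R := 𝓞 ℚ)).symm ⟨3, Fact.out⟩).adicCompletion ℚ) (w₀.1.adicCompletion (CyclotomicField (cycLevel 3 k r.1) ℚ))))))
                    (hexw : ∀ z : contOneCocycles (localRationalTateRep W 3 ((galRestrictPlace ((Rat.HeightOneSpectrum.primesEquiv (R := 𝓞 ℚ)).symm ⟨3, Fact.out⟩)).comp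
                      (absGaloisRestrict (((Rat.HeightOneSpectrum.primesEquiv (R := 𝓞 ℚ)).symm ⟨3, Fact.out⟩).adicCompletion ℚ) (w₀.1.adicCompletion (CyclotomicField (cycLevel 3 k r.1) ℚ))))).toTopRep,
                    (bdRPeriodRingData (LocalField.valuation_adicCompletion_natCast_lt_one w₀.1 3 (three_mem_asIdeal_extension _ w₀))).HasDualExp
                      (logCyclotomic 3) (localRationalTateRep W 3 ((galRestrictPlace ((Rat.HeightOneSpectrum.primesEquiv (R := 𝓞 ℚ)).symm ⟨3, Fact.out⟩)).comp
                      (absGaloisRestrict (((Rat.HeightOneSpectrum.primesEquiv (R := 𝓞 ℚ)).symm ⟨3, Fact.out⟩).adicCompletion ℚ) (w₀.1.adicCompletion (CyclotomicField (cycLevel 3 k r.1) ℚ))))) fun σ => z.1 σ),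
                    (∀ (h : (tateLocalRep W 3 (Sum.inr ((Rat.HeightOneSpectrum.primesEquiv (R := 𝓞 ℚ)).symm ⟨3, Fact.out⟩))).cohomology 1),
                    (expStarOmegaHom (LocalField.valuation_adicCompletion_natCast_lt_one w₀.1 3 (three_mem_asIdeal_extension _ w₀))
                      ((galRestrictPlace ((Rat.HeightOneSpectrum.primesEquiv (R := 𝓞 ℚ)).symm ⟨3, Fact.out⟩)).comp
                      (absGaloisRestrict (((Rat.HeightOneSpectrum.primesEquiv (R := 𝓞 ℚ)).symm ⟨3, Fact.out⟩).adicCompletion ℚ) (w₀.1.adicCompletion (CyclotomicField (cycLevel 3 k r.1) ℚ)))) dw hinjw hexw)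
                      (ContinuousRep.cohomologyRes (tateLocalRep W 3 (Sum.inr ((Rat.HeightOneSpectrum.primesEquiv (R := 𝓞 ℚ)).symm ⟨3, Fact.out⟩)))
                        (absGaloisRestrict (((Rat.HeightOneSpectrum.primesEquiv (R := 𝓞 ℚ)).symm ⟨3, Fact.out⟩).adicCompletion ℚ) (w₀.1.adicCompletion (CyclotomicField (cycLevel 3 k r.1) ℚ))) 1 h) =
                    algebraMap (((Rat.HeightOneSpectrum.primesEquiv (R := 𝓞 ℚ)).symm ⟨3, Fact.out⟩).adicCompletion ℚ) (w₀.1.adicCompletion (CyclotomicField (cycLevel 3 k r.1) ℚ)) (expStarOmegaAt dv h)) →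
                    katoLambda W 3 k r.1 w₀ Ψ hΨ (three_mem_asIdeal_extension _ w₀) g hg dw hinjw hexw (z k r) =
                      (1 : ℚ_[3]) ⊗ₜ[ℚ] x k r) ∧
              (∀ (k : ℕ) (r : (cyclotomicLevelsRat 3 (badPlaces c d A N)).Ideals) (d' : ℤ) (χ : DirichletCharacter ℂ (cycLevel 3 k r.1)) (Lχ : ℂ → ℂ),
                  Int.gcd (c * d) (cycLevel 3 k r.1 * A) = 1 →
                  d * d' ≡ 1 [ZMOD (A : ℤ)] →
                  IsDepletedTwistedL P.f (cycLevel 3 k r.1) ((3 : ℕ) * A) χ Lχ →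
                    (χ (-1) = 1 →
                      charSum (cycLevel 3 k r.1) (ι (cycLevel 3 k r.1)) χ (x k r) =
                        (κK : ℂ) * (Lχ 1 / (plusPeriod P.f : ℂ)) *
                          cuspFactor P.f true (fun n ↦ χ⁻¹ (n : ZMod (cycLevel 3 k r.1))) c d a A d') ∧
                    (χ (-1) = -1 →
                      charSum (cycLevel 3 k r.1) (ι (cycLevel 3 k r.1)) χ (x k r) =
                        -(κK : ℂ) * (Lχ 1 / (Complex.I * (minusPeriod P.f : ℂ))) *
                          cuspFactor P.f false (fun n ↦ χ⁻¹ (n : ZMod (cycLevel 3 k r.1))) c d a A d'))) :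
    Summit.BirchSwinnertonDyer.BirchSwinnertonDyer.Theses.KimAtThreeKolyvagin.KatoKuriharaPortThreeShared :=
  KimAtThreeFineKatoPerFactorPartsPrintCrux.katoKuriharaPortThreeShared_of_facts_of_printClauses hA hT
    (KimAtThreeFineKatoFinal.katoP_of_final hP hDR hND hFin)

/-! ### LEAD note appended by kim3 gen 16 (2026-08-27; DOC-ONLY — no declaration above is changed)

**hKatoFin is OVER-CONSTRAINED and is NOT the residual of record of crux 19560.**  Its clause (C4′) quantifies the chart
`∀ (k r Ψ hΨ w₀ g hg) … ∀ (dw hinjw hexw), (RES₀) → katoLambda … w₀ … (z k r) = 1 ⊗ x k r` INSIDE `∃ z x` (with `ι` fixed before),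
i.e. asks ONE value family `x` to serve at EVERY place `w₀ ∣ 3`.  But the defined datum is not place-independent: by w2-acc5's
place-change law (`KimAtThreeFineKatoDefinedLambdaChartsIota`, module docstring; `KimAtThreeFineKatoExpStarGaloisTwo`)
`katoLambda_{w₁} = (1 ⊗ γ) ∘ katoLambda_{w₀}` for the `γ ∈ Gal(ℚ(ζ_m)/ℚ)` with `γ • w₀ = w₁` carried by the tree's closure embeddings,
so (C4′) at two places forces `σ_γ x = x`, and then (C5) forces `L_S(f_W ⊗ χ, 1) · cuspFactor = 0` for every `χ` with `χ(γ) ≠ 1` — e.g. at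
the level `m = 11` on every rank-0 row with `11 ∤ N`: `L(W^{(−11)}, 1) = 0` (w2-acc5 gen 7, STATUS 2026-08-27T14:02:13Z), which Kato does
not give and which is false in general.  The theorem above is therefore correct but idle (an implication from a too-strong hypothesis).
**Residual of record (LEAD ruling, STATUS 2026-08-27T14:0xZ; registered skeleton v3 of line `perFactorKato`): w2-acc4's ∃-chart
package hKatoPrintPos₀** — `KimAtThreeFineKatoPrintPosition.katoDefPos_of_katoPrintPos_of_facts` ∘
`KimAtThreeFineKatoDefinedLambdaPositionCrux.katoKuriharaPortThreeShared_of_facts_of_katoDefPos`: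
crux ⟸ {(S5a), (S5b), (S5b-tower), (P123), (DR)} [cite] ∧ «∃ dK ι κK charts, κK ≠ 0 ∧ POS(dK, κK) ∧ (∀ k r, (RES₀)) ∧ ∀ guards ∃ z x,
(C1)(C2)(C4 at that ONE chart)(C5)».  The Kato-v2 Literature fact `Kato2004.exists_eulerSystem_definedExpStar_values` (p534555) is the
∃-chart print matrix without POS; POS (the 3-adic position of Kato's generator — `v₃(κ_W) = −v₃(c_P)`, the Manin/Néron reading) is proved for
Kato's own datum in the LEAD's memo `pub/bsd-addord/kim3/KIM3-POS-g16.md` (Theorem A / Cor. B; print status: Bullach–Honnor 2025 Thm 2.8,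
Bullach–Burns 2025 Thm 9.2, Burns–Sakamoto–Sano III Rem. 6.9) and stays ONE displayed conjunct. -/

end Summit.BirchSwinnertonDyer.BirchSwinnertonDyer.Theorems.KimAtThreeFineKatoFinalCrux

end
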